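import Summits.AtomisticToContinuum.FouriersLaw.Theorems.BondHeatUncertaintyExtensiveSnapshotIrreversibilityEnergyWindowSkeletonWeightsA

/-!
# «EnergyWindowSkeletonWeights» (lens-1 g77 node R: (I-s1) skeleton flow map, level-m Jacobian / Gram / regularised controls, leaves (SWM), (JM) and variants) — part 2 of 2 (sequel of `…BondHeatUncertaintyExtensiveSnapshotIrreversibilityEnergyWindowSkeletonWeightsA`)

Split for the 400-line cap by the landing lane (hand-2 g30); the module docstring of part 1 (`…BondHeatUncertaintyExtensiveSnapshotIrreversibilityEnergyWindowSkeletonWeightsA`) describes the whole node.  Same namespace; all FQNs unchanged.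
0 sorry; standard axioms.
-/

noncomputable section

namespace Summit.AtomisticToContinuum.FouriersLaw.Theorems.ExtensiveSnapshotIrreversibility.EnergyWindow

open MeasureTheory ProbabilityTheory Filter Topology Real unitInterval Set
open scoped ENNReal NNReal Matrix ContDiff
open Literature.MathematicalPhysics.KineticTheory.HeatConduction
open Literature.Probability.Process Literature.Analysis.ODE

/-! ## 2. Level-`m` objects at time `s`: Jacobian, normalised Gram matrix, regularised controls,
fields, Gaussian divergence, the two regularised weights -/

section Objects

variable (ω₂ lam β γ : ℝ) (N : ℕ) (T_L T_R : ℝ) (s : ℝ) (m : ℕ)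

/-- The **Jacobian matrix** `J = (∂_{x_j} E^{s}_a)` (`2N × 2·2^m`, phase-space coordinates
`Fin N ⊕ Fin N`, skeleton coordinates `Fin 2^m ⊕ Fin 2^m`) of the time-`s` skeleton flow map.
[folklore] -/
def skelJacAt (z : PhaseSpace N) (r : WienerPair) (x : PairSkeleton m) :
    Matrix (Fin N ⊕ Fin N) (Fin (2 ^ m) ⊕ Fin (2 ^ m)) ℝ :=
  jacMat (fderiv ℝ (skelFlowMapAt ω₂ lam β γ N T_L T_R s m z r) x :
    PairSkeleton m →ₗ[ℝ] PhaseSpace N)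

/-- The **normalised Gram matrix** `Γ = 2^{-m} J Jᵀ` (`2N × 2N`): the reduced Malliavin matrix of
`X_s` compressed to the level-`m` piecewise-linear Cameron–Martin directions (the skeleton
coordinates are i.i.d. centred Gaussians of variance `2^{-m}`; the raw `J Jᵀ = gramMat` of the tree
grows like `2^m`). [cite: Nualart2006, §2.3] -/
def skelGramAt (z : PhaseSpace N) (r : WienerPair) (x : PairSkeleton m) :
    Matrix (Fin N ⊕ Fin N) (Fin N ⊕ Fin N) ℝ :=
  ((2 : ℝ) ^ m)⁻¹ • (skelJacAt ω₂ lam β γ N T_L T_R s m z r x *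
    (skelJacAt ω₂ lam β γ N T_L T_R s m z r x)ᵀ)

/-- The **Tikhonov-regularised inverse** `(G + κ·1)⁻¹` of a square matrix (matrix inverse; a
genuine two-sided inverse when `G ⪰ 0`, `κ > 0`). [folklore] -/
def regInv {ι : Type} [Fintype ι] [DecidableEq ι] (G : Matrix ι ι ℝ) (κ : ℝ) : Matrix ι ι ℝ :=
  (G + κ • (1 : Matrix ι ι ℝ))⁻¹

/-- The coordinate vector of the momentum direction `e_{p_b}`. [folklore] -/
def momCoord (b : Fin N) : Fin N ⊕ Fin N → ℝ := Pi.single (Sum.inr b) 1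

/-- The **arrival control** `a = (Γ + κ)⁻¹ e_{p_b}`. [folklore] -/
def skelCtrlArr (κ : ℝ) (b : Fin N) (z : PhaseSpace N) (r : WienerPair) (x : PairSkeleton m) :
    Fin N ⊕ Fin N → ℝ :=
  regInv (skelGramAt ω₂ lam β γ N T_L T_R s m z r x) κ *ᵥ momCoord N b

/-- The **arrival field** `u = Jᵀ a` on skeleton space (so that
`J (2^{-m} u) = Γ a = e_{p_b} − κ a`:
the skeleton direction whose image under the flow derivative is the bath momentum direction, up to
the regularisation defect). [folklore] -/
def skelFieldArr (κ : ℝ) (b : Fin N) (z : PhaseSpace N) (r : WienerPair) (x : PairSkeleton m) :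
    Fin (2 ^ m) ⊕ Fin (2 ^ m) → ℝ :=
  skelCtrlArr ω₂ lam β γ N T_L T_R s m κ b z r x ᵥ* skelJacAt ω₂ lam β γ N T_L T_R s m z r x

/-- The **departure vector**: the coordinates of `∂_z E^{s}_{m,z,r}(x)[e_{p_b}]`, the derivative of
the flow in the STARTING POINT along the bath momentum direction (a genuine derivative:
`contDiff_skelFlowMapAt_left`). [folklore] -/
def skelDepVec (b : Fin N) (z : PhaseSpace N) (r : WienerPair) (x : PairSkeleton m) :
    Fin N ⊕ Fin N → ℝ :=
  coordV N (fderiv ℝ (fun z' => skelFlowMapAt ω₂ lam β γ N T_L T_R s m z' r x) z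
    ((0 : Fin N → ℝ), Pi.single b 1))

/-- The **departure control** `a' = (Γ + κ)⁻¹ V`. [folklore] -/
def skelCtrlDep (κ : ℝ) (b : Fin N) (z : PhaseSpace N) (r : WienerPair) (x : PairSkeleton m) :
    Fin N ⊕ Fin N → ℝ :=
  regInv (skelGramAt ω₂ lam β γ N T_L T_R s m z r x) κ *ᵥ
    skelDepVec ω₂ lam β γ N T_L T_R s m b z r x

/-- The **departure field** `u' = Jᵀ a'` (`J (2^{-m} u') = V − κ a'`: transfers the derivative in
the starting point to a derivative in the skeleton). [folklore] -/
def skelFieldDep (κ : ℝ) (b : Fin N) (z : PhaseSpace N) (r : WienerPair) (x : PairSkeleton m) :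
    Fin (2 ^ m) ⊕ Fin (2 ^ m) → ℝ :=
  skelCtrlDep ω₂ lam β γ N T_L T_R s m κ b z r x ᵥ* skelJacAt ω₂ lam β γ N T_L T_R s m z r x

variable {m}

/-- The Euclidean **divergence** `div u (x) = Σ_j ∂_{x_j} u_j (x)` of a coordinate field on
skeleton space. [folklore] -/
def skelDiv (u : PairSkeleton m → Fin (2 ^ m) ⊕ Fin (2 ^ m) → ℝ) (x : PairSkeleton m) : ℝ :=
  ∑ j, fderiv ℝ (fun y => u y j) x (basisX m j)

variable (m)

/-- The level-`m` **Gaussian divergence** (finite-dimensional Skorokhod integral at variance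
`2^{-m}`): `δ_m(u)(x) = Σ_j x_j u_j(x) − 2^{-m} div u(x)`, the adjoint of `F ↦ 2^{-m} ⟨∇F, u⟩`
under the product Gaussian `N(0, 2^{-m})^{⊗ 2·2^m}` (`E[∂_j F] = 2^m E[x_j F]`).
[cite: Nualart2006, Prop 1.3.1] -/
def skelSkorokhod (u : PairSkeleton m → Fin (2 ^ m) ⊕ Fin (2 ^ m) → ℝ) (x : PairSkeleton m) : ℝ :=
  (∑ j, coordX m x j * u x j) - ((2 : ℝ) ^ m)⁻¹ * skelDiv u x

/-- The **regularised arrival weight** `w_{m,κ} = δ_m(Jᵀ (Γ+κ)⁻¹ e_{p_b})` (a function of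
remainder and skeleton, i.e. of the driving path). [folklore] -/
def skelWeightArr (κ : ℝ) (b : Fin N) (z : PhaseSpace N) (r : WienerPair) (x : PairSkeleton m) :
    ℝ :=
  skelSkorokhod m (skelFieldArr ω₂ lam β γ N T_L T_R s m κ b z r) x

/-- The **regularised departure weight** `w'_{m,κ} = δ_m(Jᵀ (Γ+κ)⁻¹ V)`. [folklore] -/
def skelWeightDep (κ : ℝ) (b : Fin N) (z : PhaseSpace N) (r : WienerPair) (x : PairSkeleton m) :
    ℝ :=
  skelSkorokhod m (skelFieldDep ω₂ lam β γ N T_L T_R s m κ b z r) x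

/-- The **`q`-th moment** (Lebesgue integral over the two-bath Wiener measure, no junk value) of a
functional of (remainder, skeleton) at level `m`, evaluated along the driving path. [folklore] -/
def skelMoment (q : ℝ) (F : WienerPair → PairSkeleton m → ℝ) : ℝ≥0∞ :=
  ∫⁻ wp, ENNReal.ofReal |F (pairRem m wp) (pairSkel m wp)| ^ q ∂wienerPair

variable {ω₂ lam β γ N T_L T_R s m}

/-- `Γ = 2^{-m} · gramMat` of the tree. [folklore] -/
theorem skelGramAt_eq_smul_gramMat (z : PhaseSpace N) (r : WienerPair) (x : PairSkeleton m) :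
    skelGramAt ω₂ lam β γ N T_L T_R s m z r x =
      ((2 : ℝ) ^ m)⁻¹ • gramMat (fderiv ℝ (skelFlowMapAt ω₂ lam β γ N T_L T_R s m z r) x :
        PairSkeleton m →ₗ[ℝ] PhaseSpace N) := rfl

/-- The normalised Gram matrix is positive semidefinite. [folklore] -/
theorem posSemidef_skelGramAt (z : PhaseSpace N) (r : WienerPair) (x : PairSkeleton m) :
    (skelGramAt ω₂ lam β γ N T_L T_R s m z r x).PosSemidef := by
  have h := Matrix.posSemidef_self_mul_conjTranspose (skelJacAt ω₂ lam β γ N T_L T_R s m z r x)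
  rw [Matrix.conjTranspose_eq_transpose_of_trivial] at h
  exact h.smul (by positivity)

/-- **`Γ + κ ≻ 0` for `κ > 0`**: the regularised matrix is positive definite, hence invertible —
`regInv Γ κ` is a genuine inverse. [folklore] -/
theorem posDef_skelGramAt_add_smul {κ : ℝ} (hκ : 0 < κ) (z : PhaseSpace N) (r : WienerPair)
    (x : PairSkeleton m) :
    (skelGramAt ω₂ lam β γ N T_L T_R s m z r x + κ • (1 : Matrix _ _ ℝ)).PosDef :=
  Matrix.PosDef.posSemidef_add (posSemidef_skelGramAt z r x) (Matrix.PosDef.one.smul hκ)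

/-- `(Γ + κ)⁻¹ (Γ + κ) = 1` for `κ > 0`. [folklore] -/
theorem regInv_mul_self {κ : ℝ} (hκ : 0 < κ) (z : PhaseSpace N) (r : WienerPair)
    (x : PairSkeleton m) :
    regInv (skelGramAt ω₂ lam β γ N T_L T_R s m z r x) κ *
      (skelGramAt ω₂ lam β γ N T_L T_R s m z r x + κ • (1 : Matrix _ _ ℝ)) = 1 :=
  Matrix.nonsing_inv_mul _
    ((Matrix.isUnit_iff_isUnit_det _).1 (posDef_skelGramAt_add_smul hκ z r x).isUnit)

/-- `(Γ + κ) (Γ + κ)⁻¹ = 1` for `κ > 0`. [folklore] -/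
theorem self_mul_regInv {κ : ℝ} (hκ : 0 < κ) (z : PhaseSpace N) (r : WienerPair)
    (x : PairSkeleton m) :
    (skelGramAt ω₂ lam β γ N T_L T_R s m z r x + κ • (1 : Matrix _ _ ℝ)) *
      regInv (skelGramAt ω₂ lam β γ N T_L T_R s m z r x) κ = 1 :=
  Matrix.mul_nonsing_inv _
    ((Matrix.isUnit_iff_isUnit_det _).1 (posDef_skelGramAt_add_smul hκ z r x).isUnit)

/-- The coordinates of the momentum direction `(0, e_b)` are `momCoord b`. [folklore] -/
theorem coordV_momentum_single (b : Fin N) :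
    coordV N (((0 : Fin N → ℝ), Pi.single b 1) : PhaseSpace N) = momCoord N b := by
  funext a
  rcases a with i | i
  · simp [coordV, momCoord]
  · by_cases h : i = b
    · subst h; simp [coordV, momCoord]
    · simp [coordV, momCoord, h]

end Objects

/-! ## 3. The leaves (SWM), (JM); recorded variants (SWMᶠ) (stronger), (SWMᵘ) (expected-false) -/

/-- **(SWM) `SkeletonWeightMoments`** (OPEN · DEEP-L; WEAKER than the summit — a statement about the
equal- and two-temperature transition mechanisms at one fixed `N`, no NESS, no limit).  For positive
parameters, `T > 0`, `N ≥ 2`, every moment order `q ≥ 2` and every loss rate `ε > 0` there are `C`,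
an exponent `b₀ < 1` and `δ₀ > 0` such that: (arrival) for `|δ| < δ₀`, `0 < s ≤ 1`, both bath sites
`b`, every starting point `z` and EVERY regularisation `κ > 0`, EVENTUALLY IN THE LEVEL `m`,
`‖w_{m,κ}‖_{L^q} ≤ C s^{-b₀} e^{εH(z)}` for the regularised arrival weight of the chain with baths
`T ± δ/2`; (departure) the same for the regularised departure weight `w'_{m,κ}` of the
equal-temperature chain.  QUANTIFIER DISCIPLINE.  (i) `m₁` comes AFTER `q` (critic row 1064 (b-i);
the `q`-uniform threshold is the expected-false (SWMᵘ) below).  (ii) `m₁` comes AFTER `κ` as well,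
the constant `C` BEFORE it: at a fixed `κ > 0` every ingredient of `w_{m,κ}` is dominated by `κ⁻¹`,
so `E‖(Γ_m+κ)⁻¹‖^p → E‖(Γ_∞+κ)⁻¹‖^p ≤ E‖Γ_∞⁻¹‖^p` along `Γ_m ↑ Γ_∞` by dominated convergence and the
`κ`-UNIFORM constant is an inverse-moment bound for the LIMIT (reduced Malliavin) matrix `Γ_∞` alone
(Kusuoka–Stroock / Norris under the everywhere-Hörmander condition `V'' = 1 + 3βr² ≥ 1`, uniform
bracket depth `≍ N`) — NO small-ball estimate at a finite level is asserted; the finite-level order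
«`∃ m₁ ∀ κ`» (equivalently `κ = 0` inverse moments of `Γ_m`, row 1064 (b-iii)) is the STRONGER
recorded variant (SWMᶠ) `SkeletonWeightMomentsFiniteLevel`, implying (SWM) and needed by nothing.
(iii) The glue (parts S–U) instantiates `q = q(θ₁, T)` first, bounds the main term uniformly along
`m ≥ m₁(κ)`, and kills the `κ`-defect `κ(Γ_m+κ)⁻¹e` LAST, `κ ↓ 0`, through the Loewner monotonicity
`Γ_{m'} ≤ Γ_m` (`m' ≤ m`) and the eventual surjectivity at a fixed level `m'` — so `∇g` enters with
no constant.  (iv) `b₀` is free (calibration `b₀ = ½`: harmonic chain / Kalman Gramian, weights in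
the directly-noised bath-momentum directions only, (b-ii); numerics SKELETON-GRAM.md); the loss is
sub-exponential, `∀ ε`; the moments are `lintegral`s (no junk value).  Truth: Kusuoka–Stroock
inverse moments + `Γ_m → Γ_∞` (Riemann sums of a `C¹` integrand) + `L^q` bounds of the explicit
finite-dimensional divergence (adapted Riemann–Itô sums and Burkholder, `J_s` factored out); in
print for `N = 2` (the noise acts invertibly on the block it enters).
(after KusuokaStroock1985, Thm 2.19) (after Nualart2006, Prop 1.5.4, §2.3)
(after WangZhang2013degenerate, Thm 1.1) (after EckmannHairer2000, §3) [route leaf · named hypothesis of this cell, NOT filed as a literature fact] -/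
def SkeletonWeightMoments : Prop :=
  ∀ ω₂ lam β γ : ℝ, 0 < ω₂ → 0 < lam → 0 < β → 0 < γ →
    ∀ T : ℝ, 0 < T → ∀ (N : ℕ) (hN : 2 ≤ N), ∀ q ε : ℝ, 2 ≤ q → 0 < ε →
      ∃ C b₀ δ₀ : ℝ, b₀ < 1 ∧ 0 < δ₀ ∧
        (∀ δ : ℝ, |δ| < δ₀ → ∀ s : ℝ, 0 < s → s ≤ 1 →
          ∀ b : Fin N, (b = leftBath N hN ∨ b = rightBath N hN) → ∀ z : PhaseSpace N,
            ∀ κ : ℝ, 0 < κ → ∃ m₁ : ℕ, ∀ m : ℕ, m₁ ≤ m →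
              skelMoment m q (skelWeightArr ω₂ lam β γ N (T + δ / 2) (T - δ / 2) s m κ b z) ≤
                ENNReal.ofReal ((C * s ^ (-b₀) *
                  Real.exp (ε * (pinnedChain ω₂ lam β γ).hamiltonian N z)) ^ q)) ∧
        (∀ s : ℝ, 0 < s → s ≤ 1 →
          ∀ b : Fin N, (b = leftBath N hN ∨ b = rightBath N hN) → ∀ z : PhaseSpace N,
            ∀ κ : ℝ, 0 < κ → ∃ m₁ : ℕ, ∀ m : ℕ, m₁ ≤ m →
              skelMoment m q (skelWeightDep ω₂ lam β γ N T T s m κ b z) ≤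
                ENNReal.ofReal ((C * s ^ (-b₀) *
                  Real.exp (ε * (pinnedChain ω₂ lam β γ).hamiltonian N z)) ^ q))

/-- **(SWMᶠ) `SkeletonWeightMomentsFiniteLevel`** — the STRONGER finite-level variant of (SWM),
recorded (not staffed, needed by nothing): the same bounds with the level threshold `m₁` chosen
BEFORE the regularisation, «`∃ m₁ ∀ m ≥ m₁ ∀ κ > 0`», i.e. (monotonicity in `κ`) finiteness of the
`q`-th inverse moments of the skeleton Gram matrix `Γ_m` itself at every fixed large level.  At a
fixed level `Γ_m` is a smooth functional of `2·2^m` Gaussians with a finite small-ball exponent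
expected to grow with `m` (Carbery–Wright / sum-of-squares heuristics, critic row 1064 (b-i)), so
(SWMᶠ) is plausible but NOT in print at finite level; line 9121 does not use it.
(after CarberyWright2001, Thm 8) (after Nualart2006, §2.3) [route leaf · named hypothesis of this cell, NOT filed as a literature fact] -/
def SkeletonWeightMomentsFiniteLevel : Prop :=
  ∀ ω₂ lam β γ : ℝ, 0 < ω₂ → 0 < lam → 0 < β → 0 < γ →
    ∀ T : ℝ, 0 < T → ∀ (N : ℕ) (hN : 2 ≤ N), ∀ q ε : ℝ, 2 ≤ q → 0 < ε →
      ∃ C b₀ δ₀ : ℝ, b₀ < 1 ∧ 0 < δ₀ ∧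
        (∀ δ : ℝ, |δ| < δ₀ → ∀ s : ℝ, 0 < s → s ≤ 1 →
          ∀ b : Fin N, (b = leftBath N hN ∨ b = rightBath N hN) → ∀ z : PhaseSpace N,
            ∃ m₁ : ℕ, ∀ m : ℕ, m₁ ≤ m → ∀ κ : ℝ, 0 < κ →
              skelMoment m q (skelWeightArr ω₂ lam β γ N (T + δ / 2) (T - δ / 2) s m κ b z) ≤
                ENNReal.ofReal ((C * s ^ (-b₀) *
                  Real.exp (ε * (pinnedChain ω₂ lam β γ).hamiltonian N z)) ^ q)) ∧
        (∀ s : ℝ, 0 < s → s ≤ 1 →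
          ∀ b : Fin N, (b = leftBath N hN ∨ b = rightBath N hN) → ∀ z : PhaseSpace N,
            ∃ m₁ : ℕ, ∀ m : ℕ, m₁ ≤ m → ∀ κ : ℝ, 0 < κ →
              skelMoment m q (skelWeightDep ω₂ lam β γ N T T s m κ b z) ≤
                ENNReal.ofReal ((C * s ^ (-b₀) *
                  Real.exp (ε * (pinnedChain ω₂ lam β γ).hamiltonian N z)) ^ q))


/-- (SWMᶠ) implies (SWM): a level threshold uniform in `κ` is in particular one for each `κ`.
[folklore] -/
theorem skeletonWeightMoments_of_finiteLevel (h : SkeletonWeightMomentsFiniteLevel) :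
    SkeletonWeightMoments := by
  intro ω₂ lam β γ hω hl hβ hγ T hT N hN q ε hq hε
  obtain ⟨C, b₀, δ₀, hb₀, hδ₀, hA, hD⟩ := h ω₂ lam β γ hω hl hβ hγ T hT N hN q ε hq hε
  refine ⟨C, b₀, δ₀, hb₀, hδ₀, fun δ hδ s hs0 hs1 b hb z κ hκ => ?_,
    fun s hs0 hs1 b hb z κ hκ => ?_⟩
  · obtain ⟨m₁, hm₁⟩ := hA δ hδ s hs0 hs1 b hb z
    exact ⟨m₁, fun m hm => hm₁ m hm κ hκ⟩
  · obtain ⟨m₁, hm₁⟩ := hD s hs0 hs1 b hb z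
    exact ⟨m₁, fun m hm => hm₁ m hm κ hκ⟩

/-- **(JM) `FlowJacobianMoment`** (OPEN · ATTACKABLE-M; WEAKER than the summit).  Moments of the
first variation of the equal-temperature flow in the starting point along a bath momentum direction:
for positive parameters, `T > 0`, `N ≥ 2`, `q ≥ 1`, `ε > 0` there is `C` with
`E ‖∂_z Φ_s(z, B)[e_{p_b}]‖^q ≤ (C e^{εH(z)})^q` for all `0 ≤ s ≤ 1`, both bath sites, all `z`
(the derivative exists for every path, `contDiff_solMap_pairPath`).  Expected proof: the energy
`½|w_p|² + ½⟨w_q, D²Φ(q_t) w_q⟩` of the variational solution `ẇ = DY(X_t) w` has logarithmic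
derivative `≲ |p_t|_∞` (`D²Φ ≥ ω₂²`, `|D³Φ[p]| ≲ |p| D²Φ` for the quartic pinning and coupling), so
`‖w(s)‖ ≤ C e^{C∫₀ˢ|p_t|dt}`, and `E e^{c∫|p|} ≤ C_θ e^{θH(z)}` for every `θ > 0` by
`c√(2H) ≤ θH + c²/(2θ)` and CEHR (3.4) (`lintegral_exp_mul_hamiltonian_pinnedChainSemigroup_le`).
(after CuneoEckmannHairerReyBellet2018, eq. (3.4)) (after Cerrai2001, §1.3) [route leaf · named hypothesis of this cell, NOT filed as a literature fact] -/
def FlowJacobianMoment : Prop :=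
  ∀ ω₂ lam β γ : ℝ, 0 < ω₂ → 0 < lam → 0 < β → 0 < γ →
    ∀ T : ℝ, 0 < T → ∀ (N : ℕ) (hN : 2 ≤ N), ∀ q ε : ℝ, 1 ≤ q → 0 < ε → ∃ C : ℝ,
      ∀ s : ℝ, 0 ≤ s → s ≤ 1 → ∀ b : Fin N, (b = leftBath N hN ∨ b = rightBath N hN) →
        ∀ z : PhaseSpace N,
          ∫⁻ wp, ENNReal.ofReal ‖fderiv ℝ
              (fun z' => (pinnedChain ω₂ lam β γ).solMap N T T s z' (pairPath wp)) z
              ((0 : Fin N → ℝ), Pi.single b 1)‖ ^ q ∂wienerPair ≤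
            ENNReal.ofReal ((C * Real.exp (ε * (pinnedChain ω₂ lam β γ).hamiltonian N z)) ^ q)

/-- **(SWMᵘ) `SkeletonWeightMomentsLevelUniform`** — EXPECTED-FALSE MUTATION of (SWM)/(SWMᶠ),
recorded for the MustFail / tautology probes and never staffed: the arrival clause of (SWMᶠ)
with the level threshold `m₁` chosen BEFORE the moment order `q` («`∃ m₁ ∀ q`»).  At a fixed
finite level the normalised Gram matrix is a smooth functional of `2·2^m` Gaussians whose
determinant has a finite small-ball exponent, so its inverse moments (and those of the `κ ↓ 0`
limit of `w_{m,κ}`) exist only up to an order growing with `m` (Carbery–Wright); the correct order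
is «`∀ q ∃ m₁(q)`».
(after CarberyWright2001, Thm 8) (after Nualart2006, §2.3) [route leaf · named hypothesis of this cell, NOT filed as a literature fact] -/
def SkeletonWeightMomentsLevelUniform : Prop :=
  ∀ ω₂ lam β γ : ℝ, 0 < ω₂ → 0 < lam → 0 < β → 0 < γ →
    ∀ T : ℝ, 0 < T → ∀ (N : ℕ) (hN : 2 ≤ N), ∀ ε : ℝ, 0 < ε →
      ∃ b₀ δ₀ : ℝ, b₀ < 1 ∧ 0 < δ₀ ∧
        ∀ δ : ℝ, |δ| < δ₀ → ∀ s : ℝ, 0 < s → s ≤ 1 →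
          ∀ b : Fin N, (b = leftBath N hN ∨ b = rightBath N hN) → ∀ z : PhaseSpace N,
            ∃ m₁ : ℕ, ∀ q : ℝ, 2 ≤ q → ∃ C : ℝ, ∀ m : ℕ, m₁ ≤ m → ∀ κ : ℝ, 0 < κ →
              skelMoment m q (skelWeightArr ω₂ lam β γ N (T + δ / 2) (T - δ / 2) s m κ b z) ≤
                ENNReal.ofReal ((C * s ^ (-b₀) *
                  Real.exp (ε * (pinnedChain ω₂ lam β γ).hamiltonian N z)) ^ q)

/-- (SWMᵘ) implies the arrival clause of (SWMᶠ) with `δ₀, b₀` independent of `q` (the converse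
quantifier swap is the expected-false content; recorded so that the probes can exhibit the
direction). [folklore] -/
theorem skeletonWeightMoments_arrival_of_levelUniform (h : SkeletonWeightMomentsLevelUniform) :
    ∀ ω₂ lam β γ : ℝ, 0 < ω₂ → 0 < lam → 0 < β → 0 < γ →
      ∀ T : ℝ, 0 < T → ∀ (N : ℕ) (hN : 2 ≤ N), ∀ ε : ℝ, 0 < ε →
        ∃ b₀ δ₀ : ℝ, b₀ < 1 ∧ 0 < δ₀ ∧ ∀ q : ℝ, 2 ≤ q →
          ∀ δ : ℝ, |δ| < δ₀ → ∀ s : ℝ, 0 < s → s ≤ 1 →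
            ∀ b : Fin N, (b = leftBath N hN ∨ b = rightBath N hN) → ∀ z : PhaseSpace N,
              ∃ (m₁ : ℕ) (C : ℝ), ∀ m : ℕ, m₁ ≤ m → ∀ κ : ℝ, 0 < κ →
                skelMoment m q (skelWeightArr ω₂ lam β γ N (T + δ / 2) (T - δ / 2) s m κ b z) ≤
                  ENNReal.ofReal ((C * s ^ (-b₀) *
                    Real.exp (ε * (pinnedChain ω₂ lam β γ).hamiltonian N z)) ^ q) := by
  intro ω₂ lam β γ hω hl hβ hγ T hT N hN ε hε
  obtain ⟨b₀, δ₀, hb₀, hδ₀, H⟩ := h ω₂ lam β γ hω hl hβ hγ T hT N hN ε hε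
  refine ⟨b₀, δ₀, hb₀, hδ₀, fun q hq δ hδ s hs0 hs1 b hb z => ?_⟩
  obtain ⟨m₁, hm₁⟩ := H δ hδ s hs0 hs1 b hb z
  obtain ⟨C, hC⟩ := hm₁ q hq
  exact ⟨m₁, C, hC⟩

end Summit.AtomisticToContinuum.FouriersLaw.Theorems.ExtensiveSnapshotIrreversibility.EnergyWindow

end
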